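import Literature.NumberTheory.Automorphic.Liu2021.Prop413ConstituentsOfDictionary
import HarnessLib

/-!
# [Liu 2021] proof of Prop. 4.13 at `n = 3` (Rem. 4.14): the constituents of `H¹_{B,τ'}(A_∞, ℂ)` from the EXISTENCE half of the
# oscillator-triple dictionary + PAIRWISE SEPARATION of the admissible summands + multiplicity one + Def. 4.11

Topic `NumberTheory/Automorphic/Liu2021`.  KERNEL ONLY (theorems; no definition, no named fact, no `sorry`); companion of
`Prop413ConstituentsOfDictionary.lean` (p595625).  Nothing of [Liu2021] ∕ [GR91] ∕ [Rog90] is asserted: all inputs are HYPOTHESES on the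
consumer's datum `P : Prop413Data F E`.

`Prop413Data.constituents_classified_of_dictionary_of_multOne` consumes the uniqueness clause of `GelbartRogawski1991.oscillatorTriple_dictionary P`
only among ADMISSIBLE WEIGHT-ONE labels (`OscillatorTripleDictionary.admTriple_unique`).  That much follows from the pairwise non-isomorphy of the
admissible summands — «the `ℂ[𝔾(𝔸_F^∞)]`-modules in the direct sum are mutually non-isomorphic», [Liu2021, Thm. 4.18 (2)], which «follows from
Lemma D.1» (l. 2270), i.e. from App. D Lem. D.1 (1), (3) — rows the HodgeCM headline already displays (`hD3`, `hD1''`).  So a consumer holding that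
separation needs only the EXISTENCE half of the dictionary: «every irreducible constituent is `π^∞ ≅ ω(μ, ε, χ)` for SOME admissible weight-one
triple» ([GR91, Introduction p. 448 L30–33 + Thm 5.1.1]; [Liu2021, proof of Prop. 4.13, l. 2145] for all `n`).

* `Prop413Data.admTriple_unique_of_sep` — separation ⇒ uniqueness of the admissible weight-one label of a non-zero `σ`;
* `Prop413Data.constituents_classified_of_exists_of_sep_of_multOne` (+ primed form in the binder order of the skeleton's `ConstituentsAreTheta P τ'`,
  `Lines/a3-liu413.lean` :124–:129, VERBATIM) — the classification from `hex` (existence half), `hsep` (separation), `hm` (multiplicity one, l. 2145;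
  [Rog90, Thm. 13.3.1]), `hirr` ([Def. 4.11] irreducible-or-zero), `P.n = 3`;
* `Prop413Data.exists_admTriple_isIsoToOmega_of_dictionary` — the dictionary trivially supplies `hex`.

## References
* [Liu2021] Y. Liu, Camb. J. Math. **9** (2021) = arXiv:2102.11518 — Prop. 4.13 (FJcycle.tex ll. 2113–2119) with proof ll. 2121–2146, Rem. 4.14,
  Thm. 4.18 (2) (l. 2241) with proof l. 2270, Def. 4.11, App. D Lem. D.1 (1), (3) (l. 5229, 5233).
* [GelbartRogawski1991] Invent. Math. **105** (1991), Introduction p. 448 L30–33, Thm 5.1.1 p. 465.  [Rogawski1990] Ann. of Math. Stud. **123**, Thm. 13.3.1.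
* Tree: `Liu2021/Prop413ConstituentsOfDictionary.lean` (`occursInH1_constituent`, `constituent_label_injective`, `exists_constituent_isIsoToOmega`),
  `GelbartRogawski1991/OscillatorTripleDictionary.lean` (`OccursInH1`, `IsIsoToOmega`, `oscillatorTriple_dictionary`).
-/

noncomputable section

open NumberField DirectSum

namespace Literature.NumberTheory.Automorphic.Liu2021

namespace Prop413Data

open Literature.NumberTheory.GelbartRogawski1991 Literature.NumberTheory.GelbartRogawski1991.OscillatorTripleDictionary

variable {F E : Type} [Field F] [NumberField F] [IsTotallyReal F] [Field E] [NumberField E] [Algebra F E]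
  [IsTotallyComplex E] [Algebra.IsQuadraticExtension F E] {P : Prop413Data F E}

/-- An irreducible representation lives on a non-zero space. [folklore] -/
private theorem nontrivial_of_isIrreducible' {G V : Type} [Group G] [AddCommGroup V] [Module ℂ V] (ρ : Representation ℂ G V)
    (h : ρ.IsIrreducible) : Nontrivial V := by
  haveI := h
  haveI : IsSimpleModule (MonoidAlgebra ℂ G) ρ.asModule := (Representation.irreducible_iff_isSimpleModule_asModule ρ).mp h
  have : Nontrivial ρ.asModule := IsSimpleModule.nontrivial (MonoidAlgebra ℂ G) ρ.asModule
  exact this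

section Decomposition'

variable {τ' : E →+* ℂ} {ι : Type} {W : ι → Type} [∀ i, AddCommGroup (W i)] [∀ i, Module ℂ (W i)]
  (ρ : ∀ i, Representation ℂ P.G (W i)) (Ψ : P.HB τ' ≃ₗ[ℂ] (⨁ i, W i))
  (hΨ : ∀ (g : P.G) (x : P.HB τ') (i : ι), Ψ (P.rhoB τ' g x) i = ρ i g (Ψ x i))

/-- **Uniqueness of the admissible weight-one label of a non-zero representation from PAIRWISE SEPARATION of the admissible summands**
([Liu2021, Thm. 4.18 (2)] «mutually non-isomorphic», from App. D Lem. D.1 (3), l. 2270): if `σ ≠ 0` and `σ ≅ ω_{t₁}`, `σ ≅ ω_{t₂}`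
equivariantly (`t₁, t₂` admissible of weight one), then `t₁ = t₂` — compose the two isomorphisms to `ω_{t₁} ≅ ω_{t₂}`.
[cite: Liu2021, Thm. 4.18 (2) (FJcycle.tex l. 2241) with proof l. 2270; App. D Lem. D.1 (3) (l. 5233)] -/
theorem admTriple_unique_of_sep
    (hsep : ∀ s t : P.AdmTriple, Nontrivial (P.omegaAt s) →
      (∃ f : P.omegaAt s ≃ₗ[ℂ] P.omegaAt t, ∀ (g : P.G) (v : P.omegaAt s), f (P.rhoAt s g v) = P.rhoAt t g (f v)) → s = t)
    {W₀ : Type} [AddCommGroup W₀] [Module ℂ W₀] [Nontrivial W₀] (σ : Representation ℂ P.G W₀) {t₁ t₂ : P.AdmTriple}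
    (h₁ : IsIsoToOmega P σ t₁.1) (h₂ : IsIsoToOmega P σ t₂.1) : t₁ = t₂ := by
  obtain ⟨f₁, hf₁⟩ := h₁
  obtain ⟨f₂, hf₂⟩ := h₂
  haveI : Nontrivial (P.omegaAt t₁) := f₁.injective.nontrivial
  have hf₁' : ∀ (g : P.G) (v : P.omegaAt t₁), f₁.symm (P.rhoAt t₁ g v) = σ g (f₁.symm v) := by
    intro g v
    apply f₁.injective
    rw [LinearEquiv.apply_symm_apply, hf₁, LinearEquiv.apply_symm_apply]
  refine hsep t₁ t₂ inferInstance ⟨f₁.symm.trans f₂, fun g v => ?_⟩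
  rw [LinearEquiv.trans_apply, LinearEquiv.trans_apply, hf₁', hf₂]

include hΨ

/-- **The classification of the constituents from the EXISTENCE half of the dictionary, PAIRWISE SEPARATION of the admissible summands,
multiplicity one and Def. 4.11** — the conclusion of `constituents_classified_of_dictionary_of_multOne` (VERBATIM the body of `ConstituentsAreTheta P τ'`
of the hodgecm-mathlib skeleton `Lines/a3-liu413.lean` :124–:129) from: `hex` «every irreducible constituent of `H¹_{B,τ'}(A_∞, ℂ)` is `≅ ω_t` for SOME
admissible weight-one `t`» ([GR91, Introduction p. 448 L30–33 + Thm 5.1.1] in Liu's labels, [Liu2021, Rem. 4.14]; l. 2145 for every `n`); `hsep` the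
admissible summands are pairwise non-isomorphic ([Liu2021, Thm. 4.18 (2)], from App. D Lem. D.1 (1), (3)); `hm` multiplicity one (l. 2145; [Rog90,
Thm. 13.3.1] at `n = 3`); `hirr` [Def. 4.11]'s «irreducible» (irreducible-or-zero) for the admissible `ω_t`.  PROOF: as
`constituents_classified_of_dictionary_of_multOne`, with the uniqueness of the label supplied by `admTriple_unique_of_sep`.  Nothing of the sources is
asserted (all four inputs are hypotheses on the consumer's `P`).
[cite: Liu2021, Prop. 4.13 with proof l. 2131–2146; Rem. 4.14; Thm. 4.18 (2); Def. 4.11; App. D Lem. D.1 (3)]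
[cite: GelbartRogawski1991, Introduction p. 448 L30–33; Thm 5.1.1 p. 465] [cite: Rogawski1990, Thm. 13.3.1] -/
theorem constituents_classified_of_exists_of_sep_of_multOne
    (hex : P.n = 3 → ∀ (τ' : E →+* ℂ) (W₀ : Type) [AddCommGroup W₀] [Module ℂ W₀] (σ : Representation ℂ P.G W₀),
      σ.IsIrreducible → OccursInH1 P τ' σ → ∃ t : P.AdmTriple, IsIsoToOmega P σ t.1)
    (hsep : ∀ s t : P.AdmTriple, Nontrivial (P.omegaAt s) →
      (∃ f : P.omegaAt s ≃ₗ[ℂ] P.omegaAt t, ∀ (g : P.G) (v : P.omegaAt s), f (P.rhoAt s g v) = P.rhoAt t g (f v)) → s = t)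
    (hm : P.MultOneAsPrinted) (hirr : ∀ t : P.AdmTriple, IsIrreducibleOrZero (P.rhoAt t)) (hn : P.n = 3)
    (hirrW : ∀ i, (ρ i).IsIrreducible) :
    ∃ e : P.AdmTriple ≃ ι, ∀ t : P.AdmTriple, ∃ f : W (e t) ≃ₗ[ℂ] P.omegaAt t,
      ∀ (g : P.G) (w : W (e t)), f (ρ (e t) g w) = P.rhoAt t g (f w) := by
  classical
  have hn3 : 3 ≤ P.n := hn.symm ▸ le_rfl
  -- label every constituent: `W_i ≅ ω_{c i}` (existence half of the dictionary)
  have hlab : ∀ i, ∃ t : P.AdmTriple, IsIsoToOmega P (ρ i) t.1 := fun i =>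
    hex hn τ' (W i) (ρ i) (hirrW i) (occursInH1_constituent ρ Ψ hΨ i (hirrW i))
  choose c hc using hlab
  -- the label map is a bijection
  have hinj : Function.Injective c := by
    intro i j hij
    haveI := nontrivial_of_isIrreducible' (ρ i) (hirrW i)
    exact constituent_label_injective ρ Ψ hΨ hm hn3 (c j) (hij ▸ hc i) (hc j)
  have hsurj : Function.Surjective c := by
    intro t
    obtain ⟨i, hi⟩ := exists_constituent_isIsoToOmega ρ Ψ hΨ hm hn3 hirr hirrW t
    haveI := nontrivial_of_isIrreducible' (ρ i) (hirrW i)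
    exact ⟨i, admTriple_unique_of_sep hsep (ρ i) (hc i) hi⟩
  let e : P.AdmTriple ≃ ι := (Equiv.ofBijective c ⟨hinj, hsurj⟩).symm
  refine ⟨e, fun t => ?_⟩
  have het : c (e t) = t := Equiv.ofBijective_apply_symm_apply c ⟨hinj, hsurj⟩ t
  have h := hc (e t)
  rw [het] at h
  exact h

end Decomposition'

/-- **The same in the binder order of the skeleton's `ConstituentsAreTheta P τ'`** (decomposition data universally quantified LAST), for the
crux skeleton's one-line slot fill.
[cite: Liu2021, Prop. 4.13 with proof l. 2131–2146; Rem. 4.14; Thm. 4.18 (2); Def. 4.11]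
[cite: GelbartRogawski1991, Introduction p. 448 L30–33; Thm 5.1.1 p. 465] [cite: Rogawski1990, Thm. 13.3.1] -/
theorem constituents_classified_of_exists_of_sep_of_multOne'
    (hex : P.n = 3 → ∀ (τ' : E →+* ℂ) (W₀ : Type) [AddCommGroup W₀] [Module ℂ W₀] (σ : Representation ℂ P.G W₀),
      σ.IsIrreducible → OccursInH1 P τ' σ → ∃ t : P.AdmTriple, IsIsoToOmega P σ t.1)
    (hsep : ∀ s t : P.AdmTriple, Nontrivial (P.omegaAt s) →
      (∃ f : P.omegaAt s ≃ₗ[ℂ] P.omegaAt t, ∀ (g : P.G) (v : P.omegaAt s), f (P.rhoAt s g v) = P.rhoAt t g (f v)) → s = t)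
    (hm : P.MultOneAsPrinted) (hirr : ∀ t : P.AdmTriple, IsIrreducibleOrZero (P.rhoAt t)) (hn : P.n = 3) (τ' : E →+* ℂ) :
    ∀ (ι : Type) (W : ι → Type) [∀ i, AddCommGroup (W i)] [∀ i, Module ℂ (W i)] (ρ : ∀ i, Representation ℂ P.G (W i)),
      (∀ i, (ρ i).IsIrreducible) →
      ∀ Ψ : P.HB τ' ≃ₗ[ℂ] (⨁ i, W i), (∀ (g : P.G) (x : P.HB τ') (i : ι), Ψ (P.rhoB τ' g x) i = ρ i g (Ψ x i)) →
        ∃ e : P.AdmTriple ≃ ι, ∀ t : P.AdmTriple, ∃ f : W (e t) ≃ₗ[ℂ] P.omegaAt t,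
          ∀ (g : P.G) (w : W (e t)), f (ρ (e t) g w) = P.rhoAt t g (f w) :=
  fun _ _ _ _ ρ hirrW Ψ hΨ => constituents_classified_of_exists_of_sep_of_multOne ρ Ψ hΨ hex hsep hm hirr hn hirrW

/-- The dictionary (both clauses) trivially supplies the existence half `hex`. [cite: Liu2021, proof of Prop. 4.13, l. 2145; Rem. 4.14] -/
theorem exists_admTriple_isIsoToOmega_of_dictionary (hdict : oscillatorTriple_dictionary P) :
    P.n = 3 → ∀ (τ' : E →+* ℂ) (W₀ : Type) [AddCommGroup W₀] [Module ℂ W₀] (σ : Representation ℂ P.G W₀),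
      σ.IsIrreducible → OccursInH1 P τ' σ → ∃ t : P.AdmTriple, IsIsoToOmega P σ t.1 :=
  fun hn τ' W₀ _ _ σ hσ hocc => (hdict hn τ' W₀ σ hσ hocc).1

end Prop413Data

end Literature.NumberTheory.Automorphic.Liu2021

end
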